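import Literature.MathematicalPhysics.QuantumLattice.HubbardTTPrimeThermalWindowCertificateD4
import Literature.MathematicalPhysics.QuantumLattice.TorusSectorGibbsMixtureSpinFlip
import HarnessLib

/-!
# `t–t'` Hubbard model at `T > 0`: thermal window certificates with the FULL square-lattice symmetry set
# (translations, `U(1)×U(1)`, `D₄`, spin flip) and generic null rows, read in thermal torus-limit states

Topic `Literature/MathematicalPhysics/QuantumLattice`; final form of the thermal reader of
`HubbardTTPrimeThermalWindowCertificate(D4).lean`. A translation-invariant moment relaxation of the square
lattice identifies its variables «w.l.o.g.» under translations, the `U(1)×U(1)` gauge group (zero charge),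
the point group `D₄` and the SPIN FLIP `Γ_swap : c_{xσ} ↦ c_{x,1−σ}`; read on a single state `ω`, each
identification is a null row `ω(g·Y − Y) = 0` that `ω` must satisfy. Thermal torus limits of the canonical
`S^z = 0` sector Gibbs states satisfy ALL of them (`IsTorusLimitOfMixture.isTranslationInvariant`,
`…expect_ladderWord_eq_zero_of_sectorGibbs`, `…isD4Invariant_of_sectorGibbs`, `…spinFlip_eq_of_sectorGibbs`)
— a Gibbs state is a function of the Hamiltonian. This file adds the spin-flip defects
`Γ_swap Y_f − Y_f` (`relabel Orb.spinSwap`) and a generic null family `N_z` (hypothesis `ω(N_z) = 0`, for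
rows a reader maps by other means) to the certificate identity:

  `Xw − c·1 − Σ_σ μ_σ (n_{0σ} − ν·1) − κ (u·1 − Γ E^{tt'}_Φ)
     = Σ Λₐᵦ Oₐᴴ O_b + (Σₖ EOMₖ + Σₗ D4DEFECTₗ + Σⱼ bⱼ Wⱼ + Σ_f (Γ_swap Y_f − Y_f) + Σ_z N_z)
       + (Σᵣ λᵣ · EEB_{β,sᵣ,qᵣ}(Aᵣ) + Σₑ κₑ · Gₑ) + (Σₘ dₘ (Vₘᴴ − Vₘ) + Σₖ aₖ Wₖ)`,

* `InfVolFermionState.re_expect_ge_of_thermal_certificate_symm_TT'_of_rows` (abstract state, every state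
  property a hypothesis) and
* `IsTorusLimitOfMixture.re_expect_ge_of_thermal_certificate_symm_TT'_of_sectorGibbs` (thermal torus
  limits, `0 ≤ n ≤ 2`: eom, `D₄` defects, charged words, spin-flip defects, EEB rows and densities ALL
  discharged; the generic nulls `N_z` and extra rows `Gₑ` by name):
  `c − Σₖ ‖aₖ‖ + (Σ_σ μ_σ)(n/2 − ν) + κ (u − e^{tt'}(ω)) ≤ Re ω_{Λ'}(Xw)`.

Sources: Fawzi–Fawzi–Scalet 2024 §3.2–3.3 [FawziFawziScalet2024]; Han 2020 §3 [Han2020Bootstrap];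
Kull et al. 2024 §5.3 [KullEtAl2024]. Everything is PROVED; no definition, no named fact.
-/

noncomputable section

namespace Literature.MathematicalPhysics.QuantumLattice

open Matrix Finset HubbardWave0 Literature.Probability.LatticeModels ThermodynamicLimit
open Literature.MathematicalPhysics.QuantumManyBody.StateRelaxation
open _root_.Filter
open scoped _root_.Topology ComplexOrder BigOperators

namespace InfVolFermionState

/-- **The thermal window certificate with the full symmetry set, read in an ABSTRACT state.** As
`re_expect_ge_of_thermal_certificate_TT'_of_rows`, with two more null families in the identity: spin-flip
defects `Γ_swap Y_f − Y_f` (`Y_f ∈ 𝔄_{Λ'}`) and generic nulls `N_z`; if `ω` kills the eom rows, the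
affine-`D₄` defects, the charged words, the spin-flip defects and the `N_z`, and is nonnegative on the EEB
rows (`λᵣ ≥ 0`) and on the extra rows `Gₑ` (`κₑ ≥ 0`), then
`c − Σₖ ‖aₖ‖ + Σ_σ μ_σ (Re ω_{Λ'}(n_{0σ}) − ν) + κ (u − e^{tt'}(ω)) ≤ Re ω_{Λ'}(Xw)`.
[cite: FawziFawziScalet2024, Thm. 3.6] -/
theorem re_expect_ge_of_thermal_certificate_symm_TT'_of_rows (ω : InfVolFermionState 2) (t t' U β : ℝ)
    {Λ Λ' : Finset (Site 2)} (hΛ : Λ ⊆ Λ')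
    (h0 : thicken ({0} : Finset (Site 2)) 1 ⊆ Λ') (hz : (0 : Site 2) ∈ Λ')
    (Xw : FermionOp Λ') (κ u : ℝ) (μ : Fin 2 → ℝ) (ν : ℝ)
    {m : Type*} [Fintype m] [DecidableEq m] {Λm : Matrix m m ℂ} (hΛm : Λm.PosSemidef)
    (O : m → FermionOp Λ')
    {κ' : Type*} (s : Finset κ') (B : κ' → FermionOp Λ)
    {ι : Type*} (tt : Finset ι) (γ : ι → DihedralGroup 4) (wv : ι → Site 2)
    (hsh : ∀ l, d4ShiftSet (γ l) (wv l) Λ ⊆ Λ') (Y : ι → FermionOp Λ)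
    {ρ : Type*} (uu : Finset ρ) (b : ρ → ℂ) (cw : ρ → List (Orb (PolySite Λ') × Bool))
    {φ : Type*} (ff : Finset φ) (Yf : φ → FermionOp Λ')
    {ζ : Type*} (zz : Finset ζ) (Nz : ζ → FermionOp Λ')
    {θ : Type*} (rr : Finset θ) (lam : θ → ℝ) (A : θ → FermionOp Λ) (sv qv : θ → ℝ)
    {η : Type*} (gg : Finset η) (kap : η → ℝ) (G : η → FermionOp Λ')
    {δ : Type*} (ah : Finset δ) (dc : δ → ℝ) (V : δ → FermionOp Λ')
    {κ'' : Type*} (w : Finset κ'') (a : κ'' → ℂ) (word : κ'' → List (Orb (PolySite Λ') × Bool)) {c : ℝ}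
    (hcert : Xw - (c : ℂ) • (1 : FermionOp Λ') -
        ∑ σ : Fin 2, ((μ σ : ℝ) : ℂ) • (nAt 0 hz σ - ((ν : ℝ) : ℂ) • (1 : FermionOp Λ')) -
        ((κ : ℝ) : ℂ) • (((u : ℝ) : ℂ) • (1 : FermionOp Λ') -
          fermionEmbed (PolySite.incl h0) ((hubbardTTPrimeFermionInteraction t t' U).meanEnergyObs 1)) =
      gramForm Λm O +
        (∑ k ∈ s, ((hubbardTTPrimeFermionInteraction t t' U).localHamiltonian Λ' * fermionEmbed (PolySite.incl hΛ) (B k) -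
            fermionEmbed (PolySite.incl hΛ) (B k) * (hubbardTTPrimeFermionInteraction t t' U).localHamiltonian Λ') +
          ∑ l ∈ tt, (fermionEmbed (PolySite.incl (hsh l)) (fermionEmbed (PolySite.d4Emb (γ l) (wv l) Λ) (Y l)) -
            fermionEmbed (PolySite.incl hΛ) (Y l)) +
          ∑ j ∈ uu, b j • ladderWord (cw j) +
          ∑ f ∈ ff, (relabel (Orb.spinSwap : Orb (PolySite Λ') ≃ Orb (PolySite Λ')) (Yf f) - Yf f) +
          ∑ z ∈ zz, Nz z) +
        (∑ r ∈ rr, ((lam r : ℝ) : ℂ) •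
            (((β : ℝ) : ℂ) • ((fermionEmbed (PolySite.incl hΛ) (A r))ᴴ *
                ((hubbardTTPrimeFermionInteraction t t' U).localHamiltonian Λ' * fermionEmbed (PolySite.incl hΛ) (A r) -
                  fermionEmbed (PolySite.incl hΛ) (A r) * (hubbardTTPrimeFermionInteraction t t' U).localHamiltonian Λ')) -
              ((sv r : ℝ) : ℂ) • ((fermionEmbed (PolySite.incl hΛ) (A r))ᴴ * fermionEmbed (PolySite.incl hΛ) (A r)) +
              ((qv r : ℝ) : ℂ) • (fermionEmbed (PolySite.incl hΛ) (A r) * (fermionEmbed (PolySite.incl hΛ) (A r))ᴴ)) +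
          ∑ e ∈ gg, ((kap e : ℝ) : ℂ) • G e) +
        (∑ m' ∈ ah, ((dc m' : ℝ) : ℂ) • ((V m')ᴴ - V m') + ∑ k ∈ w, a k • ladderWord (word k)))
    (heom : ∀ k ∈ s, ω.expect Λ'
        ((hubbardTTPrimeFermionInteraction t t' U).localHamiltonian Λ' * fermionEmbed (PolySite.incl hΛ) (B k) -
          fermionEmbed (PolySite.incl hΛ) (B k) * (hubbardTTPrimeFermionInteraction t t' U).localHamiltonian Λ') = 0)
    (hsym : ∀ l ∈ tt, ω.expect Λ'
        (fermionEmbed (PolySite.incl (hsh l)) (fermionEmbed (PolySite.d4Emb (γ l) (wv l) Λ) (Y l)) -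
          fermionEmbed (PolySite.incl hΛ) (Y l)) = 0)
    (hch : ∀ j ∈ uu, ω.expect Λ' (ladderWord (cw j)) = 0)
    (hflip : ∀ f ∈ ff, ω.expect Λ' (relabel (Orb.spinSwap : Orb (PolySite Λ') ≃ Orb (PolySite Λ')) (Yf f) - Yf f) = 0)
    (hnull : ∀ z ∈ zz, ω.expect Λ' (Nz z) = 0)
    (hlam : ∀ r ∈ rr, 0 ≤ lam r)
    (heeb : ∀ r ∈ rr, 0 ≤ (ω.expect Λ'
        (((β : ℝ) : ℂ) • ((fermionEmbed (PolySite.incl hΛ) (A r))ᴴ *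
            ((hubbardTTPrimeFermionInteraction t t' U).localHamiltonian Λ' * fermionEmbed (PolySite.incl hΛ) (A r) -
              fermionEmbed (PolySite.incl hΛ) (A r) * (hubbardTTPrimeFermionInteraction t t' U).localHamiltonian Λ')) -
          ((sv r : ℝ) : ℂ) • ((fermionEmbed (PolySite.incl hΛ) (A r))ᴴ * fermionEmbed (PolySite.incl hΛ) (A r)) +
          ((qv r : ℝ) : ℂ) • (fermionEmbed (PolySite.incl hΛ) (A r) * (fermionEmbed (PolySite.incl hΛ) (A r))ᴴ))).re)
    (hkap : ∀ e ∈ gg, 0 ≤ kap e) (hG : ∀ e ∈ gg, 0 ≤ (ω.expect Λ' (G e)).re) :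
    c - ∑ k ∈ w, ‖a k‖ + ∑ σ : Fin 2, μ σ * ((ω.expect Λ' (nAt 0 hz σ)).re - ν) +
        κ * (u - ω.meanEnergy (hubbardTTPrimeFermionInteraction t t' U) 1) ≤
      (ω.expect Λ' Xw).re := by
  have hpos : ∀ A' : FermionOp Λ', 0 ≤ ω.expect Λ' (star A' * A') := fun A' => by
    rw [Matrix.star_eq_conjTranspose]
    exact ω.expect_nonneg Λ' A'
  -- the null rows
  have hn : ω.expect Λ'
      (∑ k ∈ s, ((hubbardTTPrimeFermionInteraction t t' U).localHamiltonian Λ' * fermionEmbed (PolySite.incl hΛ) (B k) -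
          fermionEmbed (PolySite.incl hΛ) (B k) * (hubbardTTPrimeFermionInteraction t t' U).localHamiltonian Λ') +
        ∑ l ∈ tt, (fermionEmbed (PolySite.incl (hsh l)) (fermionEmbed (PolySite.d4Emb (γ l) (wv l) Λ) (Y l)) -
          fermionEmbed (PolySite.incl hΛ) (Y l)) +
        ∑ j ∈ uu, b j • ladderWord (cw j) +
        ∑ f ∈ ff, (relabel (Orb.spinSwap : Orb (PolySite Λ') ≃ Orb (PolySite Λ')) (Yf f) - Yf f) +
        ∑ z ∈ zz, Nz z) = 0 := by
    rw [map_add, map_add, map_add, map_add, map_sum, map_sum, map_sum, map_sum, map_sum,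
      Finset.sum_eq_zero heom, Finset.sum_eq_zero hsym,
      Finset.sum_eq_zero (fun j hj => by rw [map_smul, hch j hj, smul_zero]), Finset.sum_eq_zero hflip,
      Finset.sum_eq_zero hnull]
    simp only [add_zero]
  -- the nonnegative rows
  have hg : 0 ≤ (ω.expect Λ'
      (∑ r ∈ rr, ((lam r : ℝ) : ℂ) •
          (((β : ℝ) : ℂ) • ((fermionEmbed (PolySite.incl hΛ) (A r))ᴴ *
              ((hubbardTTPrimeFermionInteraction t t' U).localHamiltonian Λ' * fermionEmbed (PolySite.incl hΛ) (A r) -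
                fermionEmbed (PolySite.incl hΛ) (A r) * (hubbardTTPrimeFermionInteraction t t' U).localHamiltonian Λ')) -
            ((sv r : ℝ) : ℂ) • ((fermionEmbed (PolySite.incl hΛ) (A r))ᴴ * fermionEmbed (PolySite.incl hΛ) (A r)) +
            ((qv r : ℝ) : ℂ) • (fermionEmbed (PolySite.incl hΛ) (A r) * (fermionEmbed (PolySite.incl hΛ) (A r))ᴴ)) +
        ∑ e ∈ gg, ((kap e : ℝ) : ℂ) • G e)).re := by
    rw [map_add, Complex.add_re, map_sum, map_sum, Complex.re_sum, Complex.re_sum]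
    refine add_nonneg (Finset.sum_nonneg fun r hr => ?_) (Finset.sum_nonneg fun e he => ?_)
    · rw [map_smul, smul_eq_mul, Complex.re_ofReal_mul]
      exact mul_nonneg (hlam r hr) (heeb r hr)
    · rw [map_smul, smul_eq_mul, Complex.re_ofReal_mul]
      exact mul_nonneg (hkap e he) (hG e he)
  -- the residual
  have hah : (ω.expect Λ' (∑ m' ∈ ah, ((dc m' : ℝ) : ℂ) • ((V m')ᴴ - V m'))).re = 0 := by
    rw [map_sum, Complex.re_sum]
    refine Finset.sum_eq_zero fun m' _ => ?_
    rw [map_smul, smul_eq_mul]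
    exact ω.re_ofReal_mul_expect_conjTranspose_sub_self Λ' (dc m') (V m')
  have hr : -(∑ k ∈ w, ‖a k‖) ≤ (ω.expect Λ'
      (∑ m' ∈ ah, ((dc m' : ℝ) : ℂ) • ((V m')ᴴ - V m') + ∑ k ∈ w, a k • ladderWord (word k))).re := by
    rw [map_add, Complex.add_re, hah, zero_add]
    exact neg_sum_norm_le_re_map_sum w (ω.expect Λ') a (fun k => ladderWord (word k))
      fun k _ => ω.neg_norm_le_re_mul_expect_ladderWord Λ' (a k) (word k)
  have hcert' : (Xw - ∑ σ : Fin 2, ((μ σ : ℝ) : ℂ) • (nAt 0 hz σ - ((ν : ℝ) : ℂ) • (1 : FermionOp Λ')) -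
        ((κ : ℝ) : ℂ) • (((u : ℝ) : ℂ) • (1 : FermionOp Λ') -
          fermionEmbed (PolySite.incl h0) ((hubbardTTPrimeFermionInteraction t t' U).meanEnergyObs 1))) -
        (c : ℂ) • (1 : FermionOp Λ') =
      gramForm Λm O +
        (∑ k ∈ s, ((hubbardTTPrimeFermionInteraction t t' U).localHamiltonian Λ' * fermionEmbed (PolySite.incl hΛ) (B k) -
            fermionEmbed (PolySite.incl hΛ) (B k) * (hubbardTTPrimeFermionInteraction t t' U).localHamiltonian Λ') +
          ∑ l ∈ tt, (fermionEmbed (PolySite.incl (hsh l)) (fermionEmbed (PolySite.d4Emb (γ l) (wv l) Λ) (Y l)) -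
            fermionEmbed (PolySite.incl hΛ) (Y l)) +
          ∑ j ∈ uu, b j • ladderWord (cw j) +
          ∑ f ∈ ff, (relabel (Orb.spinSwap : Orb (PolySite Λ') ≃ Orb (PolySite Λ')) (Yf f) - Yf f) +
          ∑ z ∈ zz, Nz z) +
        (∑ r ∈ rr, ((lam r : ℝ) : ℂ) •
            (((β : ℝ) : ℂ) • ((fermionEmbed (PolySite.incl hΛ) (A r))ᴴ *
                ((hubbardTTPrimeFermionInteraction t t' U).localHamiltonian Λ' * fermionEmbed (PolySite.incl hΛ) (A r) -
                  fermionEmbed (PolySite.incl hΛ) (A r) * (hubbardTTPrimeFermionInteraction t t' U).localHamiltonian Λ')) -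
              ((sv r : ℝ) : ℂ) • ((fermionEmbed (PolySite.incl hΛ) (A r))ᴴ * fermionEmbed (PolySite.incl hΛ) (A r)) +
              ((qv r : ℝ) : ℂ) • (fermionEmbed (PolySite.incl hΛ) (A r) * (fermionEmbed (PolySite.incl hΛ) (A r))ᴴ)) +
          ∑ e ∈ gg, ((kap e : ℝ) : ℂ) • G e) +
        (∑ m' ∈ ah, ((dc m' : ℝ) : ℂ) • ((V m')ᴴ - V m') + ∑ k ∈ w, a k • ladderWord (word k)) := by
    rw [← hcert]
    abel
  have hmain := le_re_map_of_certificate_rows (ω.expect Λ') hpos (ω.expect_one Λ') hΛm O hn hg hr hcert'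
  have hlhs : (ω.expect Λ' (Xw -
        ∑ σ : Fin 2, ((μ σ : ℝ) : ℂ) • (nAt 0 hz σ - ((ν : ℝ) : ℂ) • (1 : FermionOp Λ')) -
        ((κ : ℝ) : ℂ) • (((u : ℝ) : ℂ) • (1 : FermionOp Λ') -
          fermionEmbed (PolySite.incl h0) ((hubbardTTPrimeFermionInteraction t t' U).meanEnergyObs 1)))).re =
      (ω.expect Λ' Xw).re - ∑ σ : Fin 2, μ σ * ((ω.expect Λ' (nAt 0 hz σ)).re - ν) -
        κ * (u - ω.meanEnergy (hubbardTTPrimeFermionInteraction t t' U) 1) := by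
    rw [map_sub, map_sub, Complex.sub_re, Complex.sub_re, map_sum, Complex.re_sum, map_smul, smul_eq_mul,
      Complex.re_ofReal_mul, map_sub, map_smul, ω.expect_one, Complex.sub_re, smul_eq_mul, mul_one,
      Complex.ofReal_re, ω.compatible h0, InfVolFermionState.meanEnergy]
    congr 2
    refine Finset.sum_congr rfl fun σ _ => ?_
    rw [map_smul, smul_eq_mul, Complex.re_ofReal_mul, map_sub, map_smul, ω.expect_one, Complex.sub_re,
      smul_eq_mul, mul_one, Complex.ofReal_re]
  rw [hlhs] at hmain
  linarith

/-- **The full-symmetry thermal certificate bounds every thermal torus-limit state, densities evaluated.**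
For `ω` a torus limit of the canonical Gibbs states of `hubbardTorusTT' (Ls j) t t' U` at inverse temperature
`β` on the sectors `(rectN n (Ls j), S^z = 0)` (`0 ≤ n ≤ 2`, `Ls → ∞`), every certificate of
`re_expect_ge_of_thermal_certificate_symm_TT'_of_rows` with `thicken Λ 1 ⊆ Λ'`, charged words of nonzero
particle or spin charge, EEB generators conserving the local `N` and `S^z`, `e^{sᵣ−1} ≤ qᵣ`, `λᵣ, κₑ ≥ 0`,
`ω`-null generic rows `N_z` and `ω`-nonnegative extra rows `Gₑ`, proves
`c − Σₖ ‖aₖ‖ + (Σ_σ μ_σ)(n/2 − ν) + κ (u − e^{tt'}(ω)) ≤ Re ω_{Λ'}(Xw)` — the eom rows, affine-`D₄` defects,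
charged words, spin-flip defects, EEB rows and densities are ALL discharged by the tree's theorems on
thermal torus limits. [cite: FawziFawziScalet2024, Thm. 3.6] -/
theorem IsTorusLimitOfMixture.re_expect_ge_of_thermal_certificate_symm_TT'_of_sectorGibbs
    (t t' U : ℝ) {n : ℝ} (hn0 : 0 ≤ n) (hn2 : n ≤ 2) (β : ℝ) {ω : InfVolFermionState 2} {Ls : ℕ → ℕ}
    (h : ω.IsTorusLimitOfMixture (sectorGibbsCount n) (fun L => sectorGibbsWeightTT' β t t' U n L)
      (fun L => sectorGibbsVectorTT' t t' U n L) Ls)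
    (hLs : Tendsto Ls atTop atTop)
    {Λ Λ' : Finset (Site 2)} (hΛ : Λ ⊆ Λ') (h8 : thicken Λ 1 ⊆ Λ')
    (h0 : thicken ({0} : Finset (Site 2)) 1 ⊆ Λ') (hz : (0 : Site 2) ∈ Λ')
    (Xw : FermionOp Λ') (κ u : ℝ) (μ : Fin 2 → ℝ) (ν : ℝ)
    {m : Type*} [Fintype m] [DecidableEq m] {Λm : Matrix m m ℂ} (hΛm : Λm.PosSemidef)
    (O : m → FermionOp Λ')
    {κ' : Type*} (s : Finset κ') (B : κ' → FermionOp Λ)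
    {ι : Type*} (tt : Finset ι) (γ : ι → DihedralGroup 4) (wv : ι → Site 2)
    (hsh : ∀ l, d4ShiftSet (γ l) (wv l) Λ ⊆ Λ') (Y : ι → FermionOp Λ)
    {ρ : Type*} (uu : Finset ρ) (b : ρ → ℂ) (cw : ρ → List (Orb (PolySite Λ') × Bool))
    (hcw : ∀ j ∈ uu, ladderCharge (cw j) ≠ 0 ∨ ladderSpinCharge (cw j) ≠ 0)
    {φ : Type*} (ff : Finset φ) (Yf : φ → FermionOp Λ')
    {ζ : Type*} (zz : Finset ζ) (Nz : ζ → FermionOp Λ') (hnull : ∀ z ∈ zz, ω.expect Λ' (Nz z) = 0)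
    {θ : Type*} (rr : Finset θ) (lam : θ → ℝ) (hlam : ∀ r ∈ rr, 0 ≤ lam r) (A : θ → FermionOp Λ)
    (hAN : ∀ r ∈ rr, Commute (A r) (totalNumber : FermionOp Λ))
    (hAS : ∀ r ∈ rr, Commute (A r) (HubbardWave0.spinZ : FermionOp Λ))
    (sv qv : θ → ℝ) (hq : ∀ r ∈ rr, Real.exp (sv r - 1) ≤ qv r)
    {η : Type*} (gg : Finset η) (kap : η → ℝ) (hkap : ∀ e ∈ gg, 0 ≤ kap e) (G : η → FermionOp Λ')
    (hG : ∀ e ∈ gg, 0 ≤ (ω.expect Λ' (G e)).re)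
    {δ : Type*} (ah : Finset δ) (dc : δ → ℝ) (V : δ → FermionOp Λ')
    {κ'' : Type*} (w : Finset κ'') (a : κ'' → ℂ) (word : κ'' → List (Orb (PolySite Λ') × Bool)) {c : ℝ}
    (hcert : Xw - (c : ℂ) • (1 : FermionOp Λ') -
        ∑ σ : Fin 2, ((μ σ : ℝ) : ℂ) • (nAt 0 hz σ - ((ν : ℝ) : ℂ) • (1 : FermionOp Λ')) -
        ((κ : ℝ) : ℂ) • (((u : ℝ) : ℂ) • (1 : FermionOp Λ') -
          fermionEmbed (PolySite.incl h0) ((hubbardTTPrimeFermionInteraction t t' U).meanEnergyObs 1)) =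
      gramForm Λm O +
        (∑ k ∈ s, ((hubbardTTPrimeFermionInteraction t t' U).localHamiltonian Λ' * fermionEmbed (PolySite.incl hΛ) (B k) -
            fermionEmbed (PolySite.incl hΛ) (B k) * (hubbardTTPrimeFermionInteraction t t' U).localHamiltonian Λ') +
          ∑ l ∈ tt, (fermionEmbed (PolySite.incl (hsh l)) (fermionEmbed (PolySite.d4Emb (γ l) (wv l) Λ) (Y l)) -
            fermionEmbed (PolySite.incl hΛ) (Y l)) +
          ∑ j ∈ uu, b j • ladderWord (cw j) +
          ∑ f ∈ ff, (relabel (Orb.spinSwap : Orb (PolySite Λ') ≃ Orb (PolySite Λ')) (Yf f) - Yf f) +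
          ∑ z ∈ zz, Nz z) +
        (∑ r ∈ rr, ((lam r : ℝ) : ℂ) •
            (((β : ℝ) : ℂ) • ((fermionEmbed (PolySite.incl hΛ) (A r))ᴴ *
                ((hubbardTTPrimeFermionInteraction t t' U).localHamiltonian Λ' * fermionEmbed (PolySite.incl hΛ) (A r) -
                  fermionEmbed (PolySite.incl hΛ) (A r) * (hubbardTTPrimeFermionInteraction t t' U).localHamiltonian Λ')) -
              ((sv r : ℝ) : ℂ) • ((fermionEmbed (PolySite.incl hΛ) (A r))ᴴ * fermionEmbed (PolySite.incl hΛ) (A r)) +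
              ((qv r : ℝ) : ℂ) • (fermionEmbed (PolySite.incl hΛ) (A r) * (fermionEmbed (PolySite.incl hΛ) (A r))ᴴ)) +
          ∑ e ∈ gg, ((kap e : ℝ) : ℂ) • G e) +
        (∑ m' ∈ ah, ((dc m' : ℝ) : ℂ) • ((V m')ᴴ - V m') + ∑ k ∈ w, a k • ladderWord (word k))) :
    c - ∑ k ∈ w, ‖a k‖ + (∑ σ : Fin 2, μ σ) * (n / 2 - ν) +
        κ * (u - ω.meanEnergy (hubbardTTPrimeFermionInteraction t t' U) 1) ≤
      (ω.expect Λ' Xw).re := by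
  have hch : ∀ j ∈ uu, ω.expect Λ' (ladderWord (cw j)) = 0 := fun j hj =>
    h.expect_ladderWord_eq_zero_of_sectorGibbs t t' U n β hLs (cw j) (hcw j hj)
  have hsym : ∀ l ∈ tt, ω.expect Λ'
      (fermionEmbed (PolySite.incl (hsh l)) (fermionEmbed (PolySite.d4Emb (γ l) (wv l) Λ) (Y l)) -
        fermionEmbed (PolySite.incl hΛ) (Y l)) = 0 := fun l _ =>
    h.expect_d4Defect_eq_zero_of_sectorGibbs t t' U n β hLs hΛ (γ l) (wv l) (hsh l) (Y l)
  have hflip : ∀ f ∈ ff, ω.expect Λ'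
      (relabel (Orb.spinSwap : Orb (PolySite Λ') ≃ Orb (PolySite Λ')) (Yf f) - Yf f) = 0 := fun f _ =>
    h.expect_relabel_spinSwap_sub_eq_zero_of_sectorGibbs t t' U n β hLs (Yf f)
  have heom : ∀ k ∈ s, ω.expect Λ'
      ((hubbardTTPrimeFermionInteraction t t' U).localHamiltonian Λ' * fermionEmbed (PolySite.incl hΛ) (B k) -
        fermionEmbed (PolySite.incl hΛ) (B k) * (hubbardTTPrimeFermionInteraction t t' U).localHamiltonian Λ') = 0 :=
    fun k _ => h.expect_commutator_localHamiltonian_eq_zero_of_sectorGibbs t t' U β hLs hΛ h8 (B k)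
  have heeb : ∀ r ∈ rr, 0 ≤ (ω.expect Λ'
      (((β : ℝ) : ℂ) • ((fermionEmbed (PolySite.incl hΛ) (A r))ᴴ *
          ((hubbardTTPrimeFermionInteraction t t' U).localHamiltonian Λ' * fermionEmbed (PolySite.incl hΛ) (A r) -
            fermionEmbed (PolySite.incl hΛ) (A r) * (hubbardTTPrimeFermionInteraction t t' U).localHamiltonian Λ')) -
        ((sv r : ℝ) : ℂ) • ((fermionEmbed (PolySite.incl hΛ) (A r))ᴴ * fermionEmbed (PolySite.incl hΛ) (A r)) +
        ((qv r : ℝ) : ℂ) • (fermionEmbed (PolySite.incl hΛ) (A r) * (fermionEmbed (PolySite.incl hΛ) (A r))ᴴ))).re :=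
    fun r hr => h.re_expect_eeb_nonneg_of_sectorGibbs_of_thicken_subset t t' U β hLs hΛ h8 (hAN r hr) (hAS r hr)
      (hq r hr)
  have hmain := ω.re_expect_ge_of_thermal_certificate_symm_TT'_of_rows t t' U β hΛ h0 hz Xw κ u μ ν hΛm O s B tt γ
    wv hsh Y uu b cw ff Yf zz Nz rr lam A sv qv gg kap G ah dc V w a word hcert heom hsym hch hflip hnull hlam heeb
    hkap hG
  have hdens : ∑ σ : Fin 2, μ σ * ((ω.expect Λ' (nAt 0 hz σ)).re - ν) = (∑ σ : Fin 2, μ σ) * (n / 2 - ν) := by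
    rw [Finset.sum_mul]
    refine Finset.sum_congr rfl fun σ _ => ?_
    rw [h.re_expect_nAt_eq_of_sectorGibbs t t' U hn0 hn2 β hLs hz σ]
  rw [hdens] at hmain
  exact hmain

end InfVolFermionState

end Literature.MathematicalPhysics.QuantumLattice

end
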